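import Mathlib
import HarnessLib
import Summits.NavierStokesRegularity.NavierStokesRegularity.Theorems.TypeILiouvilleAxisymSectors

/-!
# TypeILiouvilleAxisymSectorsFarField — crux (L) stmt-NavierStokesRegularity-10661 `TypeIliouvilleL`:
# KNSS THEOREM 5.3 ON PRINT'S CLASS NEEDS ITS BOUND `|v| ≤ C/r` ONLY IN THE FAR FIELD AND IN THE FAR PAST

Helper for stmt-NavierStokesRegularity-10661 (`--supports`); theorems only, no definitions, no named-fact
hypotheses; closes no item; Navier–Stokes regularity is NOT proved here (leafhand seat of the EulerZoomLiouville
route; addendum to `TypeILiouvilleAxisymSectors`).  Class P = print's class of bounded ancient mild solutions.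

KNSS 2009 Theorem 5.3 (tree: `knss_bound_C_over_r_holds`; class-P form `classP_zero_of_axisymmetric_rBound`) kills
an axisymmetric bounded ancient mild flow under `r‖v(t,x)‖ ≤ C` for ALL `t < 0` and ALL `x`.  Two free reductions
available in class P make the hypothesis a pure FAR-FIELD / FAR-PAST decay condition:

* `rBound_of_farField` — boundedness `‖v‖ ≤ K` gives `r‖v‖ ≤ R₀K` inside the cylinder `r ≤ R₀`, so the bound is
  only a condition on `r ≥ R₀` («`‖v(t,x)‖ = O(1/r)` as `r → ∞`, uniformly in `t`»);
* `classP_zero_of_axisymmetric_farField_farPast_rBound` — by backward time-translation invariance of class P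
  (`TypeILiouvilleStrainLedger.classP_timeShift`) and forward rigidity (`classP_const_of_const_below`) the bound is
  only needed for `t < T` (any `T ≤ 0`): **an axisymmetric class-P flow with `‖v(t,x)‖ ≤ C/r` for `r ≥ R₀`,
  `t < T` vanishes identically**; localized-symmetry form `classP_zero_of_locally_axisymmetric_farField_farPast_rBound`
  (rotational symmetry certified on one open patch of one slice, `classP_isAxisymmetric_of_locally`).

READING for the (L) residuals: inside the AXISYMMETRIC-WITH-SWIRL cell AXL (KNSS 2009 p. 10 open problem; node
`TypeILiouvilleAxisTest`) a counterexample violates EVERY far-field/far-past `C/r` bound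
(`exists_farField_large_of_axisymmetric_nonzero`): its failure to decay like `1/r` away from the axis persists into
the arbitrarily remote past.
[cite: KochNadirashviliSereginSverak2009, Thm 5.3 (arXiv:0709.3599 p. 10), §4 (i)]
-/

noncomputable section

open MeasureTheory Filter Set Function Metric
open scoped Topology
open Literature.Analysis Literature.Analysis.FluidPDE Literature.Analysis.UnboundedOperators
open Summit.NavierStokesRegularity.NavierStokesRegularity.Theorems.TypeILiouvilleShoreline
open Summit.NavierStokesRegularity.NavierStokesRegularity.Theorems.TypeILiouvilleAxisymSectors

set_option linter.dupNamespace false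

namespace Summit.NavierStokesRegularity.NavierStokesRegularity.Theorems.TypeILiouvilleAxisymSectors

variable {v : ℝ → EuclideanSpace ℝ (Fin 3) → EuclideanSpace ℝ (Fin 3)}

/-- **The `C/r` bound is a far-field condition**: if `‖v(t,x)‖ ≤ K` on the times considered and `r‖v(t,x)‖ ≤ C`
for `r ≥ R₀`, then `r‖v(t,x)‖ ≤ max C (max R₀ 0 · K)` for all `x`. [folklore] -/
theorem rBound_of_farField {S : Set ℝ} {K C R₀ : ℝ}
    (hK : ∀ t ∈ S, ∀ x, ‖v t x‖ ≤ K)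
    (hfar : ∀ t ∈ S, ∀ x, R₀ ≤ cylRadius x → cylRadius x * ‖v t x‖ ≤ C) :
    ∀ t ∈ S, ∀ x, cylRadius x * ‖v t x‖ ≤ max C (max R₀ 0 * K) := by
  intro t ht x
  rcases le_or_gt R₀ (cylRadius x) with h | h
  · exact (hfar t ht x h).trans (le_max_left _ _)
  · have h1 : cylRadius x ≤ max R₀ 0 := h.le.trans (le_max_left _ _)
    calc cylRadius x * ‖v t x‖ ≤ max R₀ 0 * K :=
          mul_le_mul h1 (hK t ht x) (norm_nonneg _) (le_max_right _ _)
      _ ≤ max C (max R₀ 0 * K) := le_max_right _ _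

/-- **KNSS 5.3 on class P with the bound only in the FAR FIELD and the FAR PAST.**  An axisymmetric class-P flow with
`r‖v(t,x)‖ ≤ C` for `r ≥ R₀` and `t < T` (some `T ≤ 0`) vanishes identically: fill the cylinder by boundedness
(`rBound_of_farField`), translate time by `T` (class P and axisymmetry are preserved,
`TypeILiouvilleStrainLedger.classP_timeShift`), apply `classP_zero_of_axisymmetric_rBound`, and propagate `v ≡ 0`
from `t < T` forward (`classP_const_of_const_below`). [cite: KochNadirashviliSereginSverak2009, Thm 5.3 (arXiv:0709.3599 p. 10)] -/
theorem classP_zero_of_axisymmetric_farField_farPast_rBound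
    (hc : ContinuousOn (uncurry v) (Iio 0 ×ˢ univ))
    (hK : ∃ K : ℝ, ∀ t < 0, ∀ x, ‖v t x‖ ≤ K)
    (hd : ∀ t < 0, IsWeaklyDivFree (v t))
    (hm : ∀ s t : ℝ, s < t → t < 0 → ∀ x,
      v t x = heatExtension (v s) (t - s) x - oseenDuhamel 1 s v v t x)
    (haxi : ∀ t < 0, IsAxisymmetric (v t))
    {T C R₀ : ℝ} (hT : T ≤ 0)
    (hfar : ∀ t < T, ∀ x, R₀ ≤ cylRadius x → cylRadius x * ‖v t x‖ ≤ C) :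
    ∀ t < 0, ∀ x, v t x = 0 := by
  obtain ⟨K, hKb⟩ := hK
  -- fill the cylinder
  have hall : ∀ t ∈ Iio T, ∀ x, cylRadius x * ‖v t x‖ ≤ max C (max R₀ 0 * K) :=
    rBound_of_farField (S := Iio T) (fun t ht x => hKb t (lt_of_lt_of_le ht hT) x) fun t ht x hx => hfar t ht x hx
  -- translate time by `T`
  obtain ⟨hwc, hwK, hwd, hwm⟩ :=
    TypeILiouvilleStrainLedger.classP_timeShift hc ⟨K, hKb⟩ hd hm hT
  have hwaxi : ∀ t < 0, IsAxisymmetric (fun x => v (t + T) x) := fun t ht => haxi (t + T) (by linarith)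
  have hwr : ∃ C' : ℝ, ∀ t < 0, ∀ x, cylRadius x * ‖v (t + T) x‖ ≤ C' :=
    ⟨max C (max R₀ 0 * K), fun t ht x => hall (t + T) (by simp only [mem_Iio]; linarith) x⟩
  have hzero := classP_zero_of_axisymmetric_rBound (v := fun t x => v (t + T) x) hwc hwK hwd hwm hwaxi hwr
  -- `v ≡ 0` below `T`, hence everywhere
  have hbelow : ∀ τ < T, ∀ x, v τ x = 0 := fun τ hτ x => by
    have h := hzero (τ - T) (by linarith) x
    simp only [sub_add_cancel] at h
    exact h
  exact TypeILiouvilleStrainLedger.classP_const_of_const_below hc ⟨K, hKb⟩ hm hbelow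

/-- **Localized-symmetry form.**  A class-P flow which coincides with all its rotated twins about the axis on ONE
nonempty open patch of ONE slice, and obeys `r‖v(t,x)‖ ≤ C` for `r ≥ R₀`, `t < T`, vanishes identically.
[cite: KochNadirashviliSereginSverak2009, Thm 5.3 (arXiv:0709.3599 p. 10)] -/
theorem classP_zero_of_locally_axisymmetric_farField_farPast_rBound
    (hc : ContinuousOn (uncurry v) (Iio 0 ×ˢ univ))
    (hK : ∃ K : ℝ, ∀ t < 0, ∀ x, ‖v t x‖ ≤ K)
    (hd : ∀ t < 0, IsWeaklyDivFree (v t))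
    (hm : ∀ s t : ℝ, s < t → t < 0 → ∀ x,
      v t x = heatExtension (v s) (t - s) x - oseenDuhamel 1 s v v t x)
    {t₀ : ℝ} (ht₀ : t₀ < 0) {U : Set (EuclideanSpace ℝ (Fin 3))} (hUo : IsOpen U) (hUne : U.Nonempty)
    (hrot : ∀ θ : ℝ, ∀ x ∈ U, v t₀ x = rotZLIE θ (v t₀ ((rotZLIE θ).symm x)))
    {T C R₀ : ℝ} (hT : T ≤ 0)
    (hfar : ∀ t < T, ∀ x, R₀ ≤ cylRadius x → cylRadius x * ‖v t x‖ ≤ C) :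
    ∀ t < 0, ∀ x, v t x = 0 :=
  classP_zero_of_axisymmetric_farField_farPast_rBound hc hK hd hm
    (classP_isAxisymmetric_of_locally hc hK hm ht₀ hUo hUne hrot) hT hfar

/-- **Contrapositive (the residual enemy's far field).**  A NON-ZERO axisymmetric class-P flow violates every
far-field/far-past `C/r` bound: for all `T ≤ 0`, `C`, `R₀` there are `t < T` and `x` with `r ≥ R₀` and
`r‖v(t,x)‖ > C`. [cite: KochNadirashviliSereginSverak2009, Thm 5.3 and p. 10 (arXiv:0709.3599)] -/
theorem exists_farField_large_of_axisymmetric_nonzero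
    (hc : ContinuousOn (uncurry v) (Iio 0 ×ˢ univ))
    (hK : ∃ K : ℝ, ∀ t < 0, ∀ x, ‖v t x‖ ≤ K)
    (hd : ∀ t < 0, IsWeaklyDivFree (v t))
    (hm : ∀ s t : ℝ, s < t → t < 0 → ∀ x,
      v t x = heatExtension (v s) (t - s) x - oseenDuhamel 1 s v v t x)
    (haxi : ∀ t < 0, IsAxisymmetric (v t))
    (hne : ∃ t < 0, ∃ x, v t x ≠ 0) {T : ℝ} (hT : T ≤ 0) (C R₀ : ℝ) :
    ∃ t < T, ∃ x, R₀ ≤ cylRadius x ∧ C < cylRadius x * ‖v t x‖ := by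
  by_contra h
  push Not at h
  obtain ⟨t, ht, x, hx⟩ := hne
  exact hx (classP_zero_of_axisymmetric_farField_farPast_rBound hc hK hd hm haxi hT
    (fun s hs y hy => h s hs y hy) t ht x)

end Summit.NavierStokesRegularity.NavierStokesRegularity.Theorems.TypeILiouvilleAxisymSectors

end
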